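import Summits.NavierStokesRegularity.NavierStokesRegularity.Theses.AxisymmetricExtremality
import Summits.NavierStokesRegularity.NavierStokesRegularity.Theorems.AxisymmetricExtremalityAxisymmetricKatoGlobalReduction
import Summits.NavierStokesRegularity.NavierStokesRegularity.Theorems.AxisymmetricExtremalityPFoldToAxisymmetric
import Summits.NavierStokesRegularity.NavierStokesRegularity.Theorems.AxisymmetricExtremalityAxisymmetricKatoGlobalNoSwirlStratum
import Literature.Analysis.FluidPDE.AxisymmetricReflection
import HarnessLib

/-!
# Strategist sketch s16-g2 (family `s`, gen 2, independent census) for the crux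
`Theses.AxisymmetricExtremality.AxisymmetricKatoGlobal` (item stmt-NavierStokesRegularity-15453)

Typed objects behind `STRATEGY-CENSUS-s16(-g2).md`.  Everything here ELABORATES WITHOUT `sorry`;
the open mathematical content sits in the `def … : Prop` statements, never in a proof.

* §1 `NoAxisymMinimalDatum` (W₀) — the weakest statement the route's deciding theorem `closes`
  can consume in place of the crux; `noAxisymMinimalDatum_of_crux : AKG → W₀` and
  `summit_of_noAxisymMinimalDatum : MinimalDatumPFold → W₀ → NavierStokesRegularity`
  (the latter through the LANDED `axisymmetricExtremality_pFoldToAxisymmetric_proof`).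
* §2 the best both-open typed split `SwirlEvacuatesAxis ∧ SmallSwirlRegularity ⇒ AKG`
  (`crux_of_split`, kernel-checked from the landed `stub_katoAxisymSingularPoint`).
* §3 the ROUTE-LEVEL bypass (recorded for the tenure planner; not a crux strategy):
  `MinimalDatumDihedralFold → DihedralFoldToO2 → NavierStokesRegularity` (`summit_of_dihedralFold`)
  with NO `AxisymmetricKatoGlobal`, through the landed `IsAxisymmetric.hasNoSwirl_of_reflY_eq`
  (O(2)-equivariance kills the swirl) and `hasGlobalKatoSolution_of_isAxisymmetric_hasNoSwirl_viscosity`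
  (swirl-free axisymmetric `L³` data are Kato-global).
-/

noncomputable section

open Set MeasureTheory Filter Topology Function Metric
open scoped ENNReal NNReal
open Literature.Analysis.FluidPDE Literature.Analysis.FunctionSpaces

namespace Summit.NavierStokesRegularity.NavierStokesRegularity.Cruxes.AxisymmetricKatoGlobal.StrategistS16g2

open Summit.NavierStokesRegularity.NavierStokesRegularity.Theses.AxisymmetricExtremality
open Summit.NavierStokesRegularity.NavierStokesRegularity.Theorems
open Summit.NavierStokesRegularity.NavierStokesRegularity.Theorems.AxisymmetricKatoGlobal.Registered
open Summit.NavierStokesRegularity.NavierStokesRegularity.Theorems.AxisymmetricKatoGlobal.NoSwirlStratum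

/-! ## §1  The threshold instance W₀ (weakest intermediate the route can consume) -/

/-- **W₀ — no `Ḣ^{1/2}`-minimal blow-up datum is axisymmetric.**  `closes` uses the crux only at an
axisymmetric `IsMinimalBlowupDatum ν u₁ g`, so this is the weakest replacement it can consume. -/
def NoAxisymMinimalDatum : Prop :=
  ∀ ν : ℝ, 0 < ν → ∀ (u₀ : EuclideanSpace ℝ (Fin 3) → EuclideanSpace ℝ (Fin 3))
    (g : HomSobolev (EuclideanSpace ℝ (Fin 3)) (EuclideanSpace ℂ (Fin 3)) (1 / 2 : ℝ)),
    IsMinimalBlowupDatum ν u₀ g → IsAxisymmetric u₀ → False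

/-- The crux implies W₀ (drop the minimality clause). -/
theorem noAxisymMinimalDatum_of_crux (h : AxisymmetricKatoGlobal) : NoAxisymMinimalDatum := by
  intro ν hν u₀ g hmin hax
  obtain ⟨hL3, hrep, hdiv, -, hnot⟩ := hmin
  exact hnot (h ν hν u₀ g hL3 hrep hdiv (fun θ x => hax θ x))

/-- W₀ suffices for the route: `MinimalDatumPFold → W₀ → Clay (A)` (via the landed proof of
`PFoldToAxisymmetric`). -/
theorem summit_of_noAxisymMinimalDatum (h₂ : MinimalDatumPFold) (h₀ : NoAxisymMinimalDatum) :
    _root_.NavierStokesRegularity := by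
  show Literature.NS.NavierStokesExistenceSmoothR3
  intro ν hν u₀ hsm hdiv hdec
  by_contra hno
  obtain ⟨u₁, g, hmin, hax⟩ :=
    axisymmetricExtremality_pFoldToAxisymmetric_proof ν hν (h₂ ν hν ⟨u₀, hsm, hdiv, hdec, hno⟩)
  exact h₀ ν hν u₁ g hmin (fun θ x => hax θ x)

/-! ## §2  The best both-open typed split: evacuation ∧ absolute small-swirl regularity -/

/-- **Piece A (a priori / dynamics at the axis).**  Along an axisymmetric Kato solution on `[0,T)`
issued from `Ḣ^{1/2} ∩ L³` data the swirl `Γ = x₀u₁ − x₁u₀ = r u_θ` EVACUATES the axis uniformly up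
to the final time: for every `ε > 0` there are `t₀ < T` and `δ₀ > 0` with `|Γ(t,x)| ≤ ε ν` for
`cylRadius x ≤ δ₀`, `t ∈ [t₀, T)` (scale-invariant smallness: `Γ/ν` is dimensionless).  Known only
under Type I control of `u` (Hölder continuity of `Γ` at the axis by De Giorgi–Nash–Moser for the
drift equation of `Γ`); open at a Type II time, which by Seregin 2020 (arXiv:2006.04140, Thm 2.1) is
the only kind an axisymmetric singularity can be. -/
def SwirlEvacuatesAxis : Prop :=
  ∀ ν : ℝ, 0 < ν → ∀ T : ℝ, 0 < T →
    ∀ (u₀ : EuclideanSpace ℝ (Fin 3) → EuclideanSpace ℝ (Fin 3))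
      (g : HomSobolev (EuclideanSpace ℝ (Fin 3)) (EuclideanSpace ℂ (Fin 3)) (1 / 2 : ℝ))
      (u : ℝ → EuclideanSpace ℝ (Fin 3) → EuclideanSpace ℝ (Fin 3)),
      g.Represents (Literature.Analysis.FunctionSpaces.EuclideanSpace.complexify ∘ u₀) →
      IsKatoSolutionOn T ν u₀ u → ContDiffOn ℝ (⊤ : ℕ∞) (uncurry u) (Ioo 0 T ×ˢ univ) →
      (∀ t ∈ Ioo 0 T, IsAxisymmetric (u t)) →
      ∀ ε : ℝ, 0 < ε → ∃ t₀ ∈ Ioo 0 T, ∃ δ₀ : ℝ, 0 < δ₀ ∧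
        ∀ t ∈ Ico t₀ T, ∀ x : EuclideanSpace ℝ (Fin 3), cylRadius x ≤ δ₀ →
          |swirl (u t) x| ≤ ε * ν

/-- **Piece B (criterion / absolute small swirl).**  There is a universal `ε > 0` such that an
axisymmetric Kato solution on `[0,T)`, smooth on `(0,T) × ℝ³`, whose swirl obeys `|Γ| ≤ ε ν` for
`cylRadius x ≤ δ₀` on some `[t₀, T)`, is bounded near `(T, x₀)` for EVERY `x₀`.  This is the
"small-swirl regularity conjecture": the known criteria need `|Γ| ≤ C |ln r|^{-2}` (Lei–Zhang,
arXiv:1505.02628 Thm 1.2) or `C |ln r|^{-3/2}` (Wei 2016), or smallness RELATIVE to other norms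
(Lei–Zhang Thm 1.4; Lei–Ren arXiv:2210.01783 Thm 3 / Prop 17: `ε` depending on the local scaled
energy). -/
def SmallSwirlRegularity : Prop :=
  ∃ ε : ℝ, 0 < ε ∧ ∀ ν : ℝ, 0 < ν → ∀ T : ℝ, 0 < T →
    ∀ (u₀ : EuclideanSpace ℝ (Fin 3) → EuclideanSpace ℝ (Fin 3))
      (u : ℝ → EuclideanSpace ℝ (Fin 3) → EuclideanSpace ℝ (Fin 3)),
      IsKatoSolutionOn T ν u₀ u → ContDiffOn ℝ (⊤ : ℕ∞) (uncurry u) (Ioo 0 T ×ˢ univ) →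
      (∀ t ∈ Ioo 0 T, IsAxisymmetric (u t)) →
      (∃ t₀ ∈ Ioo 0 T, ∃ δ₀ : ℝ, 0 < δ₀ ∧
        ∀ t ∈ Ico t₀ T, ∀ x : EuclideanSpace ℝ (Fin 3), cylRadius x ≤ δ₀ →
          |swirl (u t) x| ≤ ε * ν) →
      ∀ x₀ : EuclideanSpace ℝ (Fin 3), IsBoundedNearTop u T x₀

/-- **Assembly of the split (kernel-checked):** `SwirlEvacuatesAxis → SmallSwirlRegularity → AKG`.
By contradiction through the landed `stub_katoAxisymSingularPoint`: a non-global axisymmetric datum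
has a Kato solution with a singular point `(T, x_*)`; evacuation with the universal `ε` of piece B
makes every point bounded near the top, contradicting `‖u‖_{L^∞(Q_r(T,x_*))} = ∞`. -/
theorem crux_of_split (hA : SwirlEvacuatesAxis) (hB : SmallSwirlRegularity) :
    AxisymmetricKatoGlobal := by
  intro ν hν u₀ g hL3 hrep hdiv hax
  have hax' : IsAxisymmetric u₀ := fun θ x => hax θ x
  by_contra hng
  obtain ⟨T, hT, xs, u, hK, hsm, haxi, hsing⟩ :=
    stub_katoAxisymSingularPoint ν hν u₀ hL3 hdiv hax' hng
  obtain ⟨ε, hε, hreg⟩ := hB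
  obtain ⟨t₀, ht₀, δ₀, hδ₀, hmod⟩ := hA ν hν T hT u₀ g u hrep hK hsm haxi ε hε
  obtain ⟨r, hr, K, hbd⟩ := hreg ν hν T hT u₀ u hK hsm haxi ⟨t₀, ht₀, δ₀, hδ₀, hmod⟩ xs
  exact absurd (hsing r hr) (eLpNorm_parabolicCylinder_lt_top_of_forall_le hbd).ne

/-! ## §3  Route-level bypass: dihedral symmetry makes the crux unnecessary -/

/-- **`MinimalDatumDihedralFold`** — the route's crux `MinimalDatumPFold` with the dihedral group
`D_p` in place of the cyclic group `C_p`: if Clay (A) fails for some datum at viscosity `ν`, then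
for every `N` there are `p ≥ max(N,2)` and an `Ḣ^{1/2}`-minimal blow-up datum equivariant under the
rotation `R_{2π/p}` AND under the meridian reflection `σ (x₀,x₁,x₂) = (x₀,−x₁,x₂)` (`reflY`).
Exactly as (im)plausible as `MinimalDatumPFold`: neither has a mechanism; both are "symmetry of
minimal blow-up data" claims. -/
def MinimalDatumDihedralFold : Prop :=
  ∀ ν : ℝ, 0 < ν →
    (∃ v₀ : EuclideanSpace ℝ (Fin 3) → EuclideanSpace ℝ (Fin 3), ContDiff ℝ (⊤ : ℕ∞) v₀ ∧
      Literature.Analysis.FluidPDE.NSWave0.IsDivFree v₀ ∧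
      Literature.Analysis.FluidPDE.HasRapidSpatialDecay v₀ ∧
      ¬ ∃ (u : ℝ → EuclideanSpace ℝ (Fin 3) → EuclideanSpace ℝ (Fin 3))
          (p : ℝ → EuclideanSpace ℝ (Fin 3) → ℝ),
          Literature.Analysis.FluidPDE.IsSmoothOnHalfSpace u ∧
          Literature.Analysis.FluidPDE.IsSmoothOnHalfSpace p ∧
          Literature.Analysis.FluidPDE.IsNavierStokesSolution ν 0 v₀ u p ∧
          Literature.Analysis.FluidPDE.HasBoundedEnergy u) →
    ∀ N : ℕ, ∃ p : ℕ, N ≤ p ∧ 2 ≤ p ∧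
      ∃ (u₀ : EuclideanSpace ℝ (Fin 3) → EuclideanSpace ℝ (Fin 3))
        (g : HomSobolev (EuclideanSpace ℝ (Fin 3)) (EuclideanSpace ℂ (Fin 3)) (1 / 2 : ℝ)),
        IsMinimalBlowupDatum ν u₀ g ∧
        (∀ x, u₀ (rotZ (2 * Real.pi / p) x) = rotZ (2 * Real.pi / p) (u₀ x)) ∧
        (∀ x, u₀ (reflY x) = reflY (u₀ x))

/-- **`DihedralFoldToO2`** — the route's compactness-modulo-similarity step (`PFoldToAxisymmetric`,
PROVED in the tree for `C_p`) run with `D_p`: dihedral-fold minimal data for all `N` give, in the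
`Ḣ^{1/2}`-limit after axis pinning, a minimal datum equivariant under a dense set of rotations and
under reflections in meridian planes at angles `kπ/p_k → ` dense, hence (closedness of the symmetry
condition in `L³`) an `O(2)`-equivariant one: axisymmetric AND `σ`-equivariant.  Provable by the
same four stubs as `axisymmetricExtremality_pFoldToAxisymmetric_proof` plus reflection covariance of
the Kato flow (`AxisymmetricReflection.lean`, `IsometryInvariance.lean`). -/
def DihedralFoldToO2 : Prop :=
  ∀ ν : ℝ, 0 < ν →
    (∀ N : ℕ, ∃ p : ℕ, N ≤ p ∧ 2 ≤ p ∧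
      ∃ (u₀ : EuclideanSpace ℝ (Fin 3) → EuclideanSpace ℝ (Fin 3))
        (g : HomSobolev (EuclideanSpace ℝ (Fin 3)) (EuclideanSpace ℂ (Fin 3)) (1 / 2 : ℝ)),
        IsMinimalBlowupDatum ν u₀ g ∧
        (∀ x, u₀ (rotZ (2 * Real.pi / p) x) = rotZ (2 * Real.pi / p) (u₀ x)) ∧
        (∀ x, u₀ (reflY x) = reflY (u₀ x))) →
    ∃ (u₀ : EuclideanSpace ℝ (Fin 3) → EuclideanSpace ℝ (Fin 3))
      (g : HomSobolev (EuclideanSpace ℝ (Fin 3)) (EuclideanSpace ℂ (Fin 3)) (1 / 2 : ℝ)),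
      IsMinimalBlowupDatum ν u₀ g ∧ IsAxisymmetric u₀ ∧ ∀ x, u₀ (reflY x) = reflY (u₀ x)

/-- **The bypass (kernel-checked): Clay (A) from the two symmetry statements alone — no
`AxisymmetricKatoGlobal`.**  An `O(2)`-equivariant field is swirl-free
(`IsAxisymmetric.hasNoSwirl_of_reflY_eq`, landed), and swirl-free axisymmetric weakly
divergence-free `L³` data are Kato-global for every `ν > 0`
(`hasGlobalKatoSolution_of_isAxisymmetric_hasNoSwirl_viscosity`, landed: Ladyzhenskaya /
Ukhovskii–Yudovich in the Kato class), contradicting the minimality clause `¬ HasGlobalKatoSolution`. -/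
theorem summit_of_dihedralFold (h₂ : MinimalDatumDihedralFold) (h₄ : DihedralFoldToO2) :
    _root_.NavierStokesRegularity := by
  show Literature.NS.NavierStokesExistenceSmoothR3
  intro ν hν u₀ hsm hdiv hdec
  by_contra hno
  obtain ⟨u₁, g, hmin, hax, hσ⟩ := h₄ ν hν (h₂ ν hν ⟨u₀, hsm, hdiv, hdec, hno⟩)
  obtain ⟨hL3, -, hdiv₁, -, hnot⟩ := hmin
  exact hnot (hasGlobalKatoSolution_of_isAxisymmetric_hasNoSwirl_viscosity hν hL3 hdiv₁ hax
    (hax.hasNoSwirl_of_reflY_eq hσ))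

/-- For comparison: with the crux in hand the dihedral clause is redundant — `MinimalDatumDihedralFold`
trivially implies `MinimalDatumPFold` (forget `σ`), so the bypass costs the route nothing it did not
already bet on, except the strengthening `C_p ↦ D_p` of the symmetry claim. -/
theorem minimalDatumPFold_of_dihedralFold (h : MinimalDatumDihedralFold) : MinimalDatumPFold := by
  intro ν hν hfail N
  obtain ⟨p, hNp, h2p, u₀, g, hmin, hrot, -⟩ := h ν hν hfail N
  exact ⟨p, hNp, h2p, u₀, g, hmin, fun x => hrot x⟩

end Summit.NavierStokesRegularity.NavierStokesRegularity.Cruxes.AxisymmetricKatoGlobal.StrategistS16g2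

end
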